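import Summits.BirchSwinnertonDyer.Rank1Residual.Partition.MainConjecturesIrreducible
import Literature.NumberTheory.EllipticCurves.Rank1Residual.X9MuInvariant
import Literature.NumberTheory.EllipticCurves.Kato2004.Condition1252
import Literature.NumberTheory.EllipticCurves.PAdicBSD
import HarnessLib

/-!
# The SURJECTIVE good-ordinary cell at `p ≥ 5`: Mazur's main conjecture — hence `BSD(E,p)` in analytic rank `0` — from Kato's INTEGRAL divisibility (Thm. 17.4 (3)), Burungale–Castella–Skinner Thm. 1.1.2 **(a)** and ONE unit coefficient of `𝓛_p(E)`

HONEST FRAMING (cell `b2b-bsdres-*`, verbatim): the cell deletes COMBINATION-SHAPED residual classes of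
the rank-≤1 BSD formula from PUBLISHED theorems only and TYPES the construction-shaped remainder; this
is not "finishing BSD". This module is about a COVERED cell (row C2: `p ≥ 5` good ordinary, `ρ̄_{E,p}`
surjective), not about a residual class; it changes no label and books nothing. Unit `b2b-bsdres-x9`,
gen 14, acting on the RESIDUAL-MAP seat's suggestion addressed to the X9 / X10b / hyp seats (HANDOFF
2026-08-20T23:43Z, rmap-1 gen 3): "the X9MuInvariant machinery (`bsdp_iff_mu_eq_zero_of_rationalMC`,
`mazurMainConjecture_of_mu_eq_zero`) specialises to the SURJECTIVE cell: Surj ∧ p ≥ 5 ⇒ (12.5.2) ⇒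
Kato 17.4 (3) INTEGRAL divisibility ⇒ μ(X) ≤ μ(L_p), so BCS 1.1.2 (a) + a μ_an = 0 certificate (one
unit coefficient of 𝓛_MSD) closes C2 r = 0 pairs" — here as kernel theorems.

## What is proved (theorems only; no definition, no named fact)

For a globally minimal `W/ℚ`, a prime `p ≥ 5` of good ORDINARY reduction with `ρ̄_{E,p}` SURJECTIVE:

* `hasSurjectiveModNGaloisRep_pow_of_surj` — `ρ̄_{E,p^n}` is onto for every `n` (Serre IV-23 via the
  tree's `Kato2004.imageContainsSL2_of_hasSurjectiveModNGaloisRep` /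
  `forall_hasSurjectiveModNGaloisRep_of_imageContainsSL2`): Kato's (12.5.2), i.e. the antecedent of
  clause (3) of the tree's named fact `kato_divisibility` (bsd.S20).
* `hasUnitContent_of_mem_span_singleton` — in `Λ = ℤ_p⟦T⟧`, if `g ∈ (g₀)` and `g` has a unit
  coefficient then so does `g₀` (`μ` can only drop along a divisibility).
* `mu_eq_zero_of_surj_of_kato_of_unitCoeff` — GREENBERG'S `μ = 0` FOR `(E, p)` IS A THEOREM HERE:
  Kato (3) gives `g₁ ∈ char_Λ X(E/ℚ_∞)` with `ι g₁ = L_p(f, α)`; BCS (a) gives `char_Λ X = (g₀)`; the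
  certificate (one coefficient of `ϖ·L_p(f,α)` of norm `1`, `ϖ` a `p`-unit by the period fact) gives
  `μ(g₁) = 0`, hence `μ(g₀) = 0`, i.e. `μ(X) = 0` (Greenberg–Vatsal's reading).
* `mazurMainConjecture_of_surj_of_kato_of_unitCoeff` — hence the INTEGRAL main conjecture in the
  Néron normalisation (`MazurMainConjecture W p`, the cell's typed predicate) by the X9 seat's gen-5
  `mazurMainConjecture_neron_of_mu_eq_zero` (BCS (a) + `μ = 0` + certificate ⇒ exponent `k = 0`).
  Compare `mazurMainConjecture_of_bcsThm112b_of_surj` (Partition/MainConjecturesIrreducible), which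
  takes BCS Thm. 1.1.2 **(b)** as the named fact: the present route uses part **(a)** and Kato's
  theorem instead of part (b), at the price of ONE finite certificate per pair (the lane's
  `μ(𝓛_p(E)) = 0`, two engines).
* `bsdp_rankZero_of_surj_of_kato_of_unitCoeff`, `RowC2.bsdp_rankZero_of_kato_of_unitCoeff` —
  `BSD(E,p)` in analytic rank `0` through the cell's universal rank-0 skeleton
  `bsdp_of_mazurMainConjecture_of_analyticRank_eq_zero` (Greenberg Thm. 4.1, modularity, GZK);
  `bsdp_rankOne_of_surj_of_kato_of_unitCoeff_of_schneider` — rank `1` along the CYCLOTOMIC route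
  modulo the per-curve Schneider certificate (skeleton `…_of_analyticRank_eq_one_of_schneider`).

* `ClassX9.not_imageContainsSL2`, `ClassX9.not_forall_hasSurjectiveModNGaloisRep_pow` (§4, appended) —
  the complement: at an X9 pair Kato's (12.5.2), i.e. the antecedent of clause (3), FAILS; the route of
  this file and class X9 partition the irreducible good-ordinary column at `p ≥ 5`
  (cf. `X9.bigIm_iff_surj_of_irr`).

Binders, all displayed: `hKato` = the tree's `kato_divisibility` (Kato 2004 Thm. 17.4, bsd.S20) for this
`(W, p)` and all cyclotomic data; `hBCS` = `burungale_castella_skinner_charIdeal_eq_padicLFunction`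
(BCS 2025 Thm. 1.1.2 (a)); `h5` = the period unit (`realPeriodRat_eq_unit_mul_plusPeriod`); `hGr`,
`hmod`, `hGZK` as in the skeleton; `hcert` = the finite certificate. Nothing here is asserted about any
particular curve; the provenance flags the referee attaches to BCS (a) travel with `hBCS` unchanged.

References: K. Kato, Astérisque 295 (2004) Thm. 17.4, Thm. 12.5 (4) [Kato2004Asterisque]; A. Burungale,
F. Castella, C. Skinner, IMRN 2025, Thm. 1.1.2 (a) [BurungaleCastellaSkinner2025]; R. Greenberg,
LNM 1716 (1999) Thm. 4.1, Conj. 1.11 [GreenbergLNM1716]; R. Greenberg, V. Vatsal, Invent. Math. 142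
(2000) (1)–(2), Prop. 3.7 [GreenbergVatsal2000]; J.-P. Serre, Abelian ℓ-adic representations (1968)
IV-23 [SerreAbelianLadic1968]; R. L. Miller, LMS JCM 14 (2011) Def. 1.1 [Miller2011LMS].
-/

set_option autoImplicit false

noncomputable section

open scoped Classical MatrixGroups ModularForm

open CongruenceSubgroup WeierstrassCurve Literature.NumberTheory.EllipticCurves
  Literature.NumberTheory.EllipticCurves.ModularForms
  Literature.NumberTheory.EllipticCurves.Rank1Residual
  Literature.NumberTheory.EllipticCurves.Rank1Residual.Typed
  Summit.BirchSwinnertonDyer.BirchSwinnertonDyer.Theorems.Rank1ResidualX1Defs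

namespace Summit.BirchSwinnertonDyer.Rank1Residual

/-! ### §1. Two lemmas -/

/-- **`μ` can only drop along a divisibility in `Λ = ℤ_p⟦T⟧`**: if `g ∈ (g₀)` and some coefficient of
`g` is a unit, then some coefficient of `g₀` is a unit (else `p ∣ g₀ ∣ g`). [folklore] -/
theorem hasUnitContent_of_mem_span_singleton {p : ℕ} [Fact p.Prime] {g g₀ : IwasawaAlgebra p}
    (hmem : g ∈ Ideal.span {g₀}) (hg : GreenbergVatsal2000.HasUnitContent g) :
    GreenbergVatsal2000.HasUnitContent g₀ := by
  rw [GreenbergVatsal2000.hasUnitContent_iff_not_C_dvd] at hg ⊢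
  exact fun h => hg (h.trans (Ideal.mem_span_singleton.mp hmem))

section Curve

variable {W : WeierstrassCurve ℚ} [W.IsElliptic] [W.IsGloballyMinimal] {p : ℕ} [Fact p.Prime]

omit [W.IsGloballyMinimal] in
/-- **`surj(p) ∧ p ≥ 5 ⟹ ρ̄_{E,p^n}` onto for all `n`** (Serre 1968 IV-23 Lemma 3 through Kato's
(12.5.2): tree theorems `Kato2004.imageContainsSL2_of_hasSurjectiveModNGaloisRep`,
`Kato2004.forall_hasSurjectiveModNGaloisRep_of_imageContainsSL2`) — the antecedent of clause (3) of
the tree's `kato_divisibility`. [cite: SerreAbelianLadic1968, Ch. IV §3.4 Lemma 3 (IV-23)]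
[cite: Kato2004Asterisque, (12.5.2) in Thm. 12.5 (4) (p. 222)] -/
theorem hasSurjectiveModNGaloisRep_pow_of_surj (hp : 5 ≤ p) (hsurj : Surj W p) (n : ℕ) :
    W.HasSurjectiveModNGaloisRep (p ^ n : ℕ) :=
  Kato2004.forall_hasSurjectiveModNGaloisRep_of_imageContainsSL2 W p
    (Kato2004.imageContainsSL2_of_hasSurjectiveModNGaloisRep W p hp hsurj) n

/-! ### §2. Greenberg's `μ = 0` and Mazur's main conjecture on the surjective cell -/

/-- **Greenberg's `μ(X(E/ℚ_∞)) = 0` on the surjective good-ordinary cell at `p ≥ 5`, from Kato (3) +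
BCS (a) + one unit coefficient.** For every cyclotomic datum `(κ, γ)` and dual datum `D`, granted a
newform `f` of `E` at level `N_E` and `ϖ` with `ϖ·Ω_E = Ω⁺_f`: Kato's clause (3) (`hKato`, with
`ρ̄_{E,p^n}` onto for all `n` by `hasSurjectiveModNGaloisRep_pow_of_surj`) gives `g₁ ∈ char_Λ X` with
`ι g₁ = L_p(f, α)`; the certificate (here one coefficient of `L_p(f, α)` of norm `1`) makes `μ(g₁) = 0`;
BCS (a) (`hBCS`) gives `char_Λ X = (g₀)`, so `μ(g₀) = 0` (`hasUnitContent_of_mem_span_singleton`), which is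
`μ(X) = 0` (`GreenbergVatsal2000.mu_eq_zero_iff_hasUnitContent`). [cite: Kato2004Asterisque, Thm. 17.4 (3) (p. 273)]
[cite: BurungaleCastellaSkinner2025, Thm. 1.1.2 (a) (p. 2 of arXiv:2405.00270v2)] [cite: GreenbergVatsal2000, p. 2, (1)–(2)] -/
theorem mu_eq_zero_of_surj_of_kato_of_unitCoeff
    (hKato : ∀ (κ : ZpExtension ℚ p) (γ : Field.absoluteGaloisGroup ℚ) (N : ℕ) [NeZero N]
      (f : CuspForm (Gamma0 N) 2), kato_divisibility W p (κ := κ) (γ := γ) (f := f))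
    (hBCS : burungale_castella_skinner_charIdeal_eq_padicLFunction)
    (hp : 5 ≤ p) (hord : GoodOrd W p) (hsurj : Surj W p)
    {N : ℕ} [NeZero N] (f : CuspForm (Gamma0 N) 2) (hf : IsNewformOf W f)
    (hcert : ∃ n : ℕ, ‖PowerSeries.coeff n (padicLFunction f (unitRoot W p : ℚ_[p]))‖ = 1)
    (κ : ZpExtension ℚ p) (γ : Field.absoluteGaloisGroup ℚ) (hκ : κ.IsCyclotomic)
    (hγ : κ.IsTopGenerator γ) (hγ' : IsCyclotomicVariable p γ) (D : W.SelmerDualData κ γ) :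
    D.mu = 0 := by
  have hp2 : p ≠ 2 := by omega
  have hirr : Irr W p := irr_of_surj W p hsurj
  haveI : Module.Finite (IwasawaAlgebra p) D.X := D.module_finite_holds hγ
  -- Kato (3): integral divisibility under (12.5.2)
  obtain ⟨-, -, h3⟩ := hKato κ γ N f hp2 ⟨hord.1, hord.2⟩ hκ hγ hγ' hf D
  obtain ⟨g₁, hg₁, hιg₁⟩ := h3 (hasSurjectiveModNGaloisRep_pow_of_surj hp hsurj)
  -- BCS (a): principal characteristic ideal, rational equality
  obtain ⟨hX, g₀, k, hchar, -⟩ := hBCS W p κ γ f hp hord.1 hord.2 hirr hκ hγ hγ' hf D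
  have hg₁u : GreenbergVatsal2000.HasUnitContent g₁ := hasUnitContent_of_map_eq g₁ _ hιg₁ hcert
  have hg₀u : GreenbergVatsal2000.HasUnitContent g₀ :=
    hasUnitContent_of_mem_span_singleton (hchar ▸ hg₁) hg₁u
  exact (GreenbergVatsal2000.mu_eq_zero_iff_hasUnitContent D hX hchar).mpr hg₀u

/-- **Mazur's main conjecture for `(E, p)` (Néron normalisation; the cell's typed predicate
`MazurMainConjecture W p`) on the surjective good-ordinary cell at `p ≥ 5`, from Kato's Thm. 17.4,
BCS 2025 Thm. 1.1.2 (a), the period unit and ONE unit coefficient of `𝓛_MSD(E) = ϖ·L_p(f, α)`**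
(`hcert`, quantified exactly as in `X9.bsdp_of_mu_eq_zero`). Deduction: `μ = 0` for every cyclotomic
dual datum (`mu_eq_zero_of_surj_of_kato_of_unitCoeff`, the newform in scope supplying Kato's and BCS's
`f`), then the X9 seat's `mazurMainConjecture_neron_of_mu_eq_zero`. Compare
`mazurMainConjecture_of_bcsThm112b_of_surj` (BCS part (b) as the named fact, no certificate).
[cite: Kato2004Asterisque, Thm. 17.4 (3) (p. 273)] [cite: BurungaleCastellaSkinner2025, Thm. 1.1.2 (a)]
[cite: GreenbergVatsal2000, Prop. 3.7 and §3 Remark (3.4)] -/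
theorem mazurMainConjecture_of_surj_of_kato_of_unitCoeff
    (hKato : ∀ (κ : ZpExtension ℚ p) (γ : Field.absoluteGaloisGroup ℚ) (N : ℕ) [NeZero N]
      (f : CuspForm (Gamma0 N) 2), kato_divisibility W p (κ := κ) (γ := γ) (f := f))
    (hBCS : burungale_castella_skinner_charIdeal_eq_padicLFunction)
    (h5 : realPeriodRat_eq_unit_mul_plusPeriod)
    (hp : 5 ≤ p) (hord : GoodOrd W p) (hsurj : Surj W p)
    (hcert : ∀ [NeZero (W.conductorNorm ℤ)] (f : CuspForm (Gamma0 (W.conductorNorm ℤ)) 2),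
        IsNewformOf W f → ∀ (ϖ : ℚ), (ϖ : ℝ) * W.realPeriodRat = plusPeriod f →
      ∃ n : ℕ, ‖PowerSeries.coeff n
        (PowerSeries.C (ϖ : ℚ_[p]) * padicLFunction f (unitRoot W p : ℚ_[p]))‖ = 1) :
    MazurMainConjecture W p := by
  intro κ γ hκ hγ hγ' _ f hf ϖ hϖeq
  have hirr : Irr W p := irr_of_surj W p hsurj
  have hϖnorm : ‖(ϖ : ℚ_[p])‖ = 1 := norm_periodRatio_eq_one h5 W p hp hord.1 hirr f hf ϖ hϖeq
  have hcert' : ∃ n : ℕ, ‖PowerSeries.coeff n (padicLFunction f (unitRoot W p : ℚ_[p]))‖ = 1 := by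
    obtain ⟨n, hn⟩ := hcert f hf ϖ hϖeq
    refine ⟨n, ?_⟩
    rwa [PowerSeries.coeff_C_mul, norm_mul, hϖnorm, one_mul] at hn
  have hμ : ∀ (κ' : ZpExtension ℚ p) (γ' : Field.absoluteGaloisGroup ℚ),
      κ'.IsCyclotomic → κ'.IsTopGenerator γ' → IsCyclotomicVariable p γ' →
      ∀ (D' : W.SelmerDualData κ' γ'), D'.mu = 0 :=
    fun κ' γ' hκ' hγ'₁ hγ'₂ D' =>
      mu_eq_zero_of_surj_of_kato_of_unitCoeff hKato hBCS hp hord hsurj f hf hcert' κ' γ' hκ' hγ'₁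
        hγ'₂ D'
  exact mazurMainConjecture_neron_of_mu_eq_zero hBCS h5 W p hp hord.1 hord.2 hirr hμ hcert κ γ hκ hγ
    hγ' f hf ϖ hϖeq

/-! ### §3. `BSD(E,p)` on the surjective cell from the certificate route -/

/-- **`BSD(E,p)` in analytic rank `0` on the surjective good-ordinary cell at `p ≥ 5`, route
"Kato (3) + BCS (a) + one unit coefficient"** — through the cell's universal rank-0 skeleton
`bsdp_of_mazurMainConjecture_of_analyticRank_eq_zero` (Greenberg Thm. 4.1 `hGr`, modularity `hmod`,
GZK `hGZK`). [cite: GreenbergLNM1716, Thm. 4.1 (p. 102)] [cite: Kato2004Asterisque, Thm. 17.4 (3) (p. 273)]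
[cite: BurungaleCastellaSkinner2025, Thm. 1.1.2 (a)] [cite: Miller2011LMS, Def. 1.1] -/
theorem bsdp_rankZero_of_surj_of_kato_of_unitCoeff
    (hKato : ∀ (κ : ZpExtension ℚ p) (γ : Field.absoluteGaloisGroup ℚ) (N : ℕ) [NeZero N]
      (f : CuspForm (Gamma0 N) 2), kato_divisibility W p (κ := κ) (γ := γ) (f := f))
    (hBCS : burungale_castella_skinner_charIdeal_eq_padicLFunction)
    (h5 : realPeriodRat_eq_unit_mul_plusPeriod) (hGr : greenberg_charValue_rankZero)
    (hmod : nonempty_modularParametrizationData) (hGZK : rank_eq_analyticRank_of_analyticRank_le_one)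
    (hp : 5 ≤ p) (hord : GoodOrd W p) (hsurj : Surj W p) (hr0 : W.analyticRank = 0)
    (hcert : ∀ [NeZero (W.conductorNorm ℤ)] (f : CuspForm (Gamma0 (W.conductorNorm ℤ)) 2),
        IsNewformOf W f → ∀ (ϖ : ℚ), (ϖ : ℝ) * W.realPeriodRat = plusPeriod f →
      ∃ n : ℕ, ‖PowerSeries.coeff n
        (PowerSeries.C (ϖ : ℚ_[p]) * padicLFunction f (unitRoot W p : ℚ_[p]))‖ = 1) :
    BSDp W p :=
  bsdp_of_mazurMainConjecture_of_analyticRank_eq_zero hGr hmod hGZK (by omega) hord hr0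
    (mazurMainConjecture_of_surj_of_kato_of_unitCoeff hKato hBCS h5 hp hord hsurj hcert)

/-- **Row C2 ∩ {r = 0}** (`¬cm ∧ 3 < p ∧ GoodOrd ∧ Irr ∧ BigIm`) **at `p ≥ 5` with `ρ̄_{E,p}` onto**:
the certificate route (the row predicate's (irr)/(im) clauses are implied by surjectivity and not used).
[cite: Kato2004Asterisque, Thm. 17.4 (3) (p. 273)] [cite: BurungaleCastellaSkinner2025, Thm. 1.1.2 (a), Cor. 1.3.1 (r = 0)] -/
theorem RowC2.bsdp_rankZero_of_kato_of_unitCoeff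
    (hKato : ∀ (κ : ZpExtension ℚ p) (γ : Field.absoluteGaloisGroup ℚ) (N : ℕ) [NeZero N]
      (f : CuspForm (Gamma0 N) 2), kato_divisibility W p (κ := κ) (γ := γ) (f := f))
    (hBCS : burungale_castella_skinner_charIdeal_eq_padicLFunction)
    (h5 : realPeriodRat_eq_unit_mul_plusPeriod) (hGr : greenberg_charValue_rankZero)
    (hmod : nonempty_modularParametrizationData) (hGZK : rank_eq_analyticRank_of_analyticRank_le_one)
    (h : RowC2 W p) (hp : 5 ≤ p) (hsurj : Surj W p) (hr0 : W.analyticRank = 0)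
    (hcert : ∀ [NeZero (W.conductorNorm ℤ)] (f : CuspForm (Gamma0 (W.conductorNorm ℤ)) 2),
        IsNewformOf W f → ∀ (ϖ : ℚ), (ϖ : ℝ) * W.realPeriodRat = plusPeriod f →
      ∃ n : ℕ, ‖PowerSeries.coeff n
        (PowerSeries.C (ϖ : ℚ_[p]) * padicLFunction f (unitRoot W p : ℚ_[p]))‖ = 1) :
    BSDp W p :=
  bsdp_rankZero_of_surj_of_kato_of_unitCoeff hKato hBCS h5 hGr hmod hGZK hp h.2.2.1 hsurj hr0 hcert

/-- **Rank `1` on the surjective cell along the CYCLOTOMIC route, modulo the Schneider certificate**: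
the certificate route's main conjecture fed to the skeleton
`bsdp_of_mazurMainConjecture_of_analyticRank_eq_one_of_schneider` (Perrin-Riou–Schneider `hS`,
Perrin-Riou 1987 `hPR`, the per-curve non-degeneracy `hSch`). In rank `1` the constant term of `𝓛_MSD(E)`
vanishes, so the certificate is a coefficient of index `≥ 1`. [cite: PerrinRiou1987, §1.4 Cor. 1.8]
[cite: BalakrishnanMullerStein2015, Thm. 1.7] [cite: Kato2004Asterisque, Thm. 17.4 (3) (p. 273)] -/
theorem bsdp_rankOne_of_surj_of_kato_of_unitCoeff_of_schneider
    (hKato : ∀ (κ : ZpExtension ℚ p) (γ : Field.absoluteGaloisGroup ℚ) (N : ℕ) [NeZero N]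
      (f : CuspForm (Gamma0 N) 2), kato_divisibility W p (κ := κ) (γ := γ) (f := f))
    (hBCS : burungale_castella_skinner_charIdeal_eq_padicLFunction)
    (h5 : realPeriodRat_eq_unit_mul_plusPeriod)
    (hS : Schneider1985_order_charGenerator) (hPR : perrinRiou_rankOne_leadingTerms)
    (hmod : nonempty_modularParametrizationData) (hGZK : rank_eq_analyticRank_of_analyticRank_le_one)
    (hp : 5 ≤ p) (hord : GoodOrd W p) (hsurj : Surj W p) (hr1 : W.analyticRank = 1)
    (hSch : ∀ Dh : PAdicHeightData W p, Dh.IsCanonical → SchneiderConjecture Dh)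
    (hcert : ∀ [NeZero (W.conductorNorm ℤ)] (f : CuspForm (Gamma0 (W.conductorNorm ℤ)) 2),
        IsNewformOf W f → ∀ (ϖ : ℚ), (ϖ : ℝ) * W.realPeriodRat = plusPeriod f →
      ∃ n : ℕ, ‖PowerSeries.coeff n
        (PowerSeries.C (ϖ : ℚ_[p]) * padicLFunction f (unitRoot W p : ℚ_[p]))‖ = 1) :
    BSDp W p :=
  bsdp_of_mazurMainConjecture_of_analyticRank_eq_one_of_schneider hS hPR hmod hGZK hp hord hr1 hSch
    (mazurMainConjecture_of_surj_of_kato_of_unitCoeff hKato hBCS h5 hp hord hsurj hcert)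

/-! ### §4. The complement: class X9 is exactly where Kato's clause (3) has no antecedent -/

/-- **An X9 pair FAILS Kato's (12.5.2)** (`ρ̄_{E,p}` not onto ⟹ the image of `Gal(ℚ̄/ℚ(ζ_{p^∞}))` does
not contain `SL₂(ℤ_p)`; tree `Kato2004.not_imageContainsSL2_of_not_hasSurjectiveModNGaloisRep`), so the
certificate route of §2–§3 is unavailable on X9 by construction — the X9 residue is this clause's
antecedent, not its algebra (gen 13's `X9/ChaDescentRoute.lean` and `X9MuInvariant.lean` state what
replaces it). [cite: Kato2004Asterisque, (12.5.2) in Thm. 12.5 (4) (p. 222)] -/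
theorem ClassX9.not_imageContainsSL2 (h : ClassX9 W p) : ¬ Kato2004.ImageContainsSL2 W p :=
  Kato2004.not_imageContainsSL2_of_not_hasSurjectiveModNGaloisRep W p h.2.2.2.2.1

/-- **Hence on X9 the surjectivity binder of `kato_divisibility` clause (3) (`ρ̄_{E,p^n}` onto for all
`n`) is FALSE** — Kato's Thm. 17.4 (3) is literally unavailable at an X9 pair (its rational clauses
(1)(2) remain). [cite: Kato2004Asterisque, Thm. 17.4 (3) (p. 273) and (12.5.2) (p. 222)] -/
theorem ClassX9.not_forall_hasSurjectiveModNGaloisRep_pow (h : ClassX9 W p) :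
    ¬ ∀ n : ℕ, W.HasSurjectiveModNGaloisRep (p ^ n : ℕ) :=
  fun hall => ClassX9.not_imageContainsSL2 h
    (Kato2004.imageContainsSL2_of_forall_hasSurjectiveModNGaloisRep W p hall)

end Curve

end Summit.BirchSwinnertonDyer.Rank1Residual

end
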